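import Summits.SmoothPoincare4.SmoothPoincare4.Theses.CongruenceShadows

/-!
# `HeegaardHandlebodyCongruenceClosed` — negative-side support: profinite freeness detection is not group theory

Support lemma for the crux `CongruenceShadows.HeegaardHandlebodyCongruenceClosed`
(stmt-SmoothPoincare4-14596), line `pair-rigidity-retraction`, stub P2 `stub_profiniteFreenessDetection`
("a twisted pair quotient `S ⧸ ⟪N_i ∪ θN₂⟫` that surjects onto exactly the finite groups `F_{m+1}`
surjects onto is free of rank `m+1`").  Drefute seat `refuter-drefute-stmt-SmoothPoincare4-14596-0`,
2026-08-16.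

**`freenessDetection_false_without_heegaardForm`.** The HEEGAARD FORM of the group in P2 (it is
`π₁` of the closed orientable 3-manifold `H_i ∪_θ H₂`) is load-bearing: for EVERY rank `k` the same
implication for an abstract group `G` — "`G` surjects onto exactly the finite groups `F_k` surjects
onto ⇒ `G ≅ F_k`" — is false, witness `G = F_k × ℚ` (`ℚ` written multiplicatively): a homomorphism to
a finite group kills the divisible factor `ℚ` (`map_rat_eq_one`), so `G` and `F_k` surject onto the
same finite groups (`sameFiniteQuotients_freeGroup_prod_rat`), while `G` is not free of rank `k`
because it surjects onto `ℚ`, which is not finitely generated (`not_addGroup_fg_rat`,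
`not_isFreeOfRank_freeGroup_prod_rat`).  Finitely presented witnesses exist as well (`F_k × Higman's
group`), and for finitely presented RESIDUALLY FINITE `G` the implication is the open absolute
profinite rigidity of `F_k` (`k ≥ 2`); the only known proof of P2 is 3-manifold topology
(Wilton–Zalesskii 2019, Thm 2.2, with Perelman) through the Heegaard form.  Moral for provers: P2
cannot be proved from its displayed hypothesis by group theory alone.
-/

noncomputable section

namespace Summit.SmoothPoincare4.SmoothPoincare4.Theorems.HeegaardHandlebodyCongruenceClosed.Negative

set_option linter.dupNamespace false

open Literature.Topology.FourManifolds

/-- The witness family `W k = F_k × ℚ` (`ℚ` multiplicative). [folklore] -/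
abbrev W (k : ℕ) : Type := FreeGroup (Fin k) × Multiplicative ℚ

/-- Every element of `ℚ` is an `n`-th power for `n ≠ 0` (divisibility, multiplicative notation). [folklore] -/
theorem exists_pow_eq_rat (y : Multiplicative ℚ) {n : ℕ} (hn : n ≠ 0) :
    ∃ z : Multiplicative ℚ, z ^ n = y := by
  refine ⟨Multiplicative.ofAdd (Multiplicative.toAdd y / n), ?_⟩
  rw [← ofAdd_nsmul, nsmul_eq_mul, mul_div_cancel₀ _ (Nat.cast_ne_zero.2 hn)]
  rfl

/-- A homomorphism from `ℚ` to a finite group is trivial. [folklore] -/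
theorem map_rat_eq_one {Q : Type} [Group Q] [Finite Q] (f : Multiplicative ℚ →* Q)
    (y : Multiplicative ℚ) : f y = 1 := by
  haveI := Fintype.ofFinite Q
  obtain ⟨z, rfl⟩ := exists_pow_eq_rat y (Fintype.card_ne_zero (α := Q))
  rw [map_pow, pow_card_eq_one]

/-- `F_k × ℚ` and `F_k` surject onto the same finite groups. [folklore] -/
theorem sameFiniteQuotients_freeGroup_prod_rat (k : ℕ) (Q : Type) [Group Q] [Finite Q] :
    (∃ f : W k →* Q, Function.Surjective f) ↔ (∃ f : FreeGroup (Fin k) →* Q, Function.Surjective f) := by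
  constructor
  · rintro ⟨f, hf⟩
    refine ⟨f.comp (MonoidHom.inl _ _), fun q => ?_⟩
    obtain ⟨⟨x, y⟩, rfl⟩ := hf q
    refine ⟨x, ?_⟩
    have hxy : ((x, y) : W k) = (MonoidHom.inl _ _ x) * (MonoidHom.inr _ _ y) := by simp
    rw [hxy, map_mul, MonoidHom.comp_apply]
    have : f (MonoidHom.inr _ _ y) = 1 := map_rat_eq_one (f.comp (MonoidHom.inr _ _)) y
    rw [this, mul_one]
  · rintro ⟨f, hf⟩
    exact ⟨f.comp (MonoidHom.fst _ _), hf.comp Prod.fst_surjective⟩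

/-- Rationals whose product with `D` is an integer form a subgroup of `ℚ`. [folklore] -/
def boundedDen (D : ℕ) : AddSubgroup ℚ where
  carrier := {x | ∃ z : ℤ, x * D = z}
  zero_mem' := ⟨0, by simp⟩
  add_mem' := by
    rintro x y ⟨a, ha⟩ ⟨b, hb⟩
    exact ⟨a + b, by push_cast; rw [add_mul, ha, hb]⟩
  neg_mem' := by
    rintro x ⟨a, ha⟩
    exact ⟨-a, by push_cast; rw [neg_mul, ha]⟩

/-- `ℚ` is not finitely generated as a group: finitely many rationals have bounded denominators. [folklore] -/
theorem not_addGroup_fg_rat : ¬ AddGroup.FG ℚ := by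
  intro h
  obtain ⟨T, hT⟩ := h.out
  set D : ℕ := ∏ q ∈ T, q.den with hD
  have hD0 : D ≠ 0 := Finset.prod_ne_zero_iff.2 fun q _ => q.den_ne_zero
  have hle : AddSubgroup.closure (T : Set ℚ) ≤ boundedDen D := by
    rw [AddSubgroup.closure_le]
    intro q hq
    obtain ⟨c, hc⟩ : q.den ∣ D := Finset.dvd_prod_of_mem _ (by simpa using hq)
    refine ⟨q.num * c, ?_⟩
    rw [hc]
    push_cast
    rw [← mul_assoc, Rat.mul_den_eq_num]
  have hx : ((1 : ℚ) / (D + 1)) ∈ boundedDen D := hle (by rw [hT]; exact AddSubgroup.mem_top _)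
  obtain ⟨z, hz⟩ := hx
  have hD1 : (D : ℚ) + 1 ≠ 0 := by positivity
  have hzq : (D : ℚ) = z * (D + 1) := by
    field_simp at hz
    linarith
  have hzz : (D : ℤ) = z * (D + 1) := by exact_mod_cast hzq
  have hDpos : (0 : ℤ) < D := by exact_mod_cast Nat.pos_of_ne_zero hD0
  rcases le_or_gt z 0 with hz0 | hz0
  · nlinarith
  · nlinarith

/-- `F_k × ℚ` is not free of rank `k` (it surjects onto `ℚ`, free groups of finite rank are finitely
generated, `ℚ` is not). [folklore] -/
theorem not_isFreeOfRank_freeGroup_prod_rat (k : ℕ) : ¬ IsFreeOfRank (W k) k := by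
  rintro ⟨e⟩
  have hfg : Group.FG (Multiplicative ℚ) :=
    Group.fg_of_surjective (f := (MonoidHom.snd _ _).comp e.toMonoidHom)
      (Prod.snd_surjective.comp e.surjective)
  exact not_addGroup_fg_rat (AddGroup.fg_iff_mul_fg.2 hfg)

/-- **P2 needs the Heegaard form (every rank).** For NO `k` is it true that every group surjecting
onto exactly the finite groups `F_k` surjects onto is free of rank `k` (witness `G = F_k × ℚ`). [folklore] -/
theorem freenessDetection_false_without_heegaardForm (k : ℕ) :
    ¬ ∀ (G : Type) [Group G],
      (∀ (Q : Type) [Group Q] [Finite Q],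
        (∃ f : G →* Q, Function.Surjective f) ↔ (∃ f : FreeGroup (Fin k) →* Q, Function.Surjective f)) →
      IsFreeOfRank G k :=
  fun h => not_isFreeOfRank_freeGroup_prod_rat k
    (h (W k) (fun Q _ _ => sameFiniteQuotients_freeGroup_prod_rat k Q))

end Summit.SmoothPoincare4.SmoothPoincare4.Theorems.HeegaardHandlebodyCongruenceClosed.Negative

end
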